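import Summits.AtomisticToContinuum.FouriersLaw.Theorems.PhononMeanFreePathIncoherentBoundedSumRule
import Summits.AtomisticToContinuum.FouriersLaw.Theses.BoundaryEscapeDeficit

/-!
# `PhononMeanFreePath.BoundaryKubo` ↔ `BoundaryEscapeDeficit.ResponseIdentity` (two rank-4 cruxes are one)

Helper file for item `stmt-AtomisticToContinuum-11812` (crux `BoundaryKubo`, route `PhononMeanFreePath`, sub-problem
`FouriersLaw`), by-product of the zeroth-moment sum rule of `…IncoherentBoundedSumRule`
(item `stmt-AtomisticToContinuum-11815`).

Both cruxes are fixed-`N` Kubo identities for BLR's response coefficient `D_N` of the pinned anharmonic chain, under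
the same hypotheses (weak-NESS uniqueness, a steady-state family `μ`, `T > 0`):

* `PhononMeanFreePath.BoundaryKubo` (stmt-AtomisticToContinuum-11812), CROSS form, `N + 1` sites:
  `C_N ∈ L¹(0,∞)` and `totalCurrent(μ_{N+1,T+δ/2,T-δ/2})/δ → N (γ²/T²) ∫_{t>0} C_N`;
* `BoundaryEscapeDeficit.ResponseIdentity` (stmt-AtomisticToContinuum-12237), AUTO form, `N ≥ 1` sites:
  `K_N ∈ L¹(0,∞)` and `totalCurrent(μ_{N,T+δ/2,T-δ/2})/δ → (N - 1) γ E_N`, `E_N = 1 - (γ/T²) ∫_{t>0} K_N`,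

where `C_N(t) = ∫ p₀² (K_t p_N²) dμ₀ - (∫ p₀² dμ₀)(∫ K_t p_N² dμ₀)` and `K_{N+1}(t) = A_N(t) = ∫ (p₀² - T) K_t(p₀² - T) dμ₀`.
The sum rule `γ (∫ A_N + ∫ C_N) = T²` (`conductance_eq_escapeDeficit`) makes the two limit VALUES equal at every `N`
(`responseValue_eq`), and both integrability clauses hold outright at fixed `N` (`CN_integrableOn`,
`kinCorr_integrableOn`, exponential mixing); the two `Tendsto` clauses are then the same statement. Hence
`boundaryKubo_iff_responseIdentity`: proving either crux proves the other.

No definitions; nothing here closes an item.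
-/

noncomputable section

open MeasureTheory ProbabilityTheory Filter Topology Set
open scoped NNReal ENNReal
open Literature.MathematicalPhysics.KineticTheory.HeatConduction
open Literature.MathematicalPhysics.KineticTheory Literature.Probability.Process OscillatorChain
open Summit.AtomisticToContinuum.FouriersLaw.Theorems.SubdiffusiveBondHeat

namespace Summit.AtomisticToContinuum.FouriersLaw.Theorems.IncoherentBounded

section Value

variable {ω₂ lam β γ : ℝ} (hω : 0 < ω₂) (hl : 0 ≤ lam) (hβ : 0 < β) (hγ : 0 < γ) {T : ℝ} (hT : 0 < T)
include hω hl hβ hγ hT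

/-- **The two Kubo values coincide.** For every `M`, with `M + 1` sites:
`((M+1) - 1) · γ · (1 - (γ/T²) ∫_{t>0} A_M) = M · (γ²/T²) · ∫_{t>0} C_M` (the sum rule `γ(∫A_M + ∫C_M) = T²`).
[cite: KunduDharNarayan2009, arXiv:0809.4543 p. 3] -/
theorem responseValue_eq (M : ℕ) :
    (((M + 1 : ℕ) : ℝ) - 1) * γ * (1 - γ / T ^ 2 * ∫ t in Ioi (0 : ℝ), ∫ z, (z.2 0 ^ 2 - T) * (∫ y, (y.2 0 ^ 2 - T)
        ∂((pinnedChain ω₂ lam β γ).transitionKernel (M + 1) T T t.toNNReal z)) ∂((pinnedChain ω₂ lam β γ).gibbsMeasure (M + 1) T)) =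
      (M : ℝ) * (γ ^ 2 / T ^ 2) * ∫ t in Ioi (0 : ℝ), ((∫ z, (z.2 0) ^ 2 * (∫ y, (y.2 (Fin.last M)) ^ 2 ∂((pinnedChain ω₂ lam β γ).transitionKernel (M + 1) T T t.toNNReal z)) ∂((pinnedChain ω₂ lam β γ).gibbsMeasure (M + 1) T)) - (∫ z, (z.2 0) ^ 2 ∂((pinnedChain ω₂ lam β γ).gibbsMeasure (M + 1) T)) * (∫ z, (∫ y, (y.2 (Fin.last M)) ^ 2 ∂((pinnedChain ω₂ lam β γ).transitionKernel (M + 1) T T t.toNNReal z)) ∂((pinnedChain ω₂ lam β γ).gibbsMeasure (M + 1) T))) := by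
  rw [mul_assoc (M : ℝ), conductance_eq_escapeDeficit hω hl hβ hγ hT M]
  push_cast
  ring

end Value

/-- **`BoundaryKubo ↔ ResponseIdentity`.** The cross-form boundary Kubo identity of route `PhononMeanFreePath`
(stmt-AtomisticToContinuum-11812) and the auto-form response identity of route `BoundaryEscapeDeficit`
(stmt-AtomisticToContinuum-12237) are equivalent: same hypotheses, same `Tendsto` clause once the limit values are
identified by the zeroth-moment sum rule (`responseValue_eq`), and both integrability clauses are theorems at fixed `N`
(`CN_integrableOn`, `kinCorr_integrableOn`). [cite: KunduDharNarayan2009, arXiv:0809.4543 p. 3] -/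
theorem boundaryKubo_iff_responseIdentity :
    Summit.AtomisticToContinuum.FouriersLaw.Theses.PhononMeanFreePath.BoundaryKubo ↔
      Summit.AtomisticToContinuum.FouriersLaw.Theses.BoundaryEscapeDeficit.ResponseIdentity := by
  -- the `K` of `ResponseIdentity` at `M + 1` sites is the near kernel `A_M`
  have hK : ∀ (ω₂ lam β γ T : ℝ) (M : ℕ) (u : ℝ),
      (if h : 0 < M + 1 then ∫ z, ((z.2 ⟨0, h⟩) ^ 2 - T) * (∫ y, ((y.2 ⟨0, h⟩) ^ 2 - T)
        ∂((pinnedChain ω₂ lam β γ).transitionKernel (M + 1) T T u.toNNReal z)) ∂((pinnedChain ω₂ lam β γ).gibbsMeasure (M + 1) T)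
        else 0) =
      ∫ z, (z.2 0 ^ 2 - T) * (∫ y, (y.2 0 ^ 2 - T)
        ∂((pinnedChain ω₂ lam β γ).transitionKernel (M + 1) T T u.toNNReal z)) ∂((pinnedChain ω₂ lam β γ).gibbsMeasure (M + 1) T) := by
    intro ω₂ lam β γ T M u
    rw [dif_pos (Nat.succ_pos M)]
    rfl
  constructor
  · intro hBK ω₂ lam β γ hω hl hβ hγ huniq μ hμ T hT P K E N hN
    obtain ⟨M, rfl⟩ : ∃ M, N = M + 1 := ⟨N - 1, by omega⟩
    have h := hBK ω₂ lam β γ hω hl hβ hγ huniq μ hμ T hT M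
    have hKM : K (M + 1) = fun u => ∫ z, (z.2 0 ^ 2 - T) * (∫ y, (y.2 0 ^ 2 - T)
        ∂((pinnedChain ω₂ lam β γ).transitionKernel (M + 1) T T u.toNNReal z)) ∂((pinnedChain ω₂ lam β γ).gibbsMeasure (M + 1) T) :=
      funext fun u => hK ω₂ lam β γ T M u
    have hEM : (((M + 1 : ℕ) : ℝ) - 1) * γ * E (M + 1) =
        (M : ℝ) * (γ ^ 2 / T ^ 2) * ∫ t in Ioi (0 : ℝ), ((∫ z, (z.2 0) ^ 2 * (∫ y, (y.2 (Fin.last M)) ^ 2 ∂((pinnedChain ω₂ lam β γ).transitionKernel (M + 1) T T t.toNNReal z)) ∂((pinnedChain ω₂ lam β γ).gibbsMeasure (M + 1) T)) - (∫ z, (z.2 0) ^ 2 ∂((pinnedChain ω₂ lam β γ).gibbsMeasure (M + 1) T)) * (∫ z, (∫ y, (y.2 (Fin.last M)) ^ 2 ∂((pinnedChain ω₂ lam β γ).transitionKernel (M + 1) T T t.toNNReal z)) ∂((pinnedChain ω₂ lam β γ).gibbsMeasure (M + 1) T))) := by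
      show (((M + 1 : ℕ) : ℝ) - 1) * γ * (1 - γ / T ^ 2 * ∫ u in Ioi (0 : ℝ), K (M + 1) u) = _
      rw [hKM]
      exact responseValue_eq hω hl.le hβ hγ hT M
    refine ⟨?_, ?_⟩
    · rw [hKM]
      exact kinCorr_integrableOn hω hl.le hβ hγ (Nat.succ_pos M) hT 0 0
    · rw [hEM]
      exact h.2
  · intro hRI ω₂ lam β γ hω hl hβ hγ huniq μ hμ T hT M
    have h := hRI ω₂ lam β γ hω hl hβ hγ huniq μ hμ T hT (M + 1) (Nat.succ_pos M)
    have hEM : ((((M + 1 : ℕ) : ℝ) - 1) * γ * (1 - γ / T ^ 2 * ∫ u in Ioi (0 : ℝ),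
        (if h : 0 < M + 1 then ∫ z, ((z.2 ⟨0, h⟩) ^ 2 - T) * (∫ y, ((y.2 ⟨0, h⟩) ^ 2 - T)
          ∂((pinnedChain ω₂ lam β γ).transitionKernel (M + 1) T T u.toNNReal z)) ∂((pinnedChain ω₂ lam β γ).gibbsMeasure (M + 1) T)
          else 0))) =
        (M : ℝ) * (γ ^ 2 / T ^ 2) * ∫ t in Ioi (0 : ℝ), ((∫ z, (z.2 0) ^ 2 * (∫ y, (y.2 (Fin.last M)) ^ 2 ∂((pinnedChain ω₂ lam β γ).transitionKernel (M + 1) T T t.toNNReal z)) ∂((pinnedChain ω₂ lam β γ).gibbsMeasure (M + 1) T)) - (∫ z, (z.2 0) ^ 2 ∂((pinnedChain ω₂ lam β γ).gibbsMeasure (M + 1) T)) * (∫ z, (∫ y, (y.2 (Fin.last M)) ^ 2 ∂((pinnedChain ω₂ lam β γ).transitionKernel (M + 1) T T t.toNNReal z)) ∂((pinnedChain ω₂ lam β γ).gibbsMeasure (M + 1) T))) := by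
      simp only [hK]
      exact responseValue_eq hω hl.le hβ hγ hT M
    refine ⟨CN_integrableOn hω hl.le hβ hγ hT M, ?_⟩
    have h2 := h.2
    rw [hEM] at h2
    exact h2

end Summit.AtomisticToContinuum.FouriersLaw.Theorems.IncoherentBounded

end
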